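import Mathlib.Analysis.SpecialFunctions.Pow.Real
import Mathlib.Analysis.SpecialFunctions.Sqrt
import Literature.ModelTheory.ExponentialFields.OMinimalCellDecomposition
import Literature.ModelTheory.ExponentialFields.OMinimalDimension
import Literature.ModelTheory.ExponentialFields.OMinimalDimensionInvariance
import Literature.ModelTheory.ExponentialFields.DefinableHomeomorph
import HarnessLib

/-!
# Local conic structure of one-dimensional definable planar sets (van den Dries 1998, Ch. 9 (2.3), `n = 2`)

Proof file (theorems only, no named facts).  L. van den Dries, *Tame topology and o-minimal
structures* (1998), Ch. 9, (2.3): a definable set `E ⊆ Rⁿ` has, at each of its points `p`, a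
LOCAL CONIC STRUCTURE — for small `ε > 0` a definable homeomorphism of the closed ball `B(p, ε)`
preserving `‖· − p‖` carries `E ∩ B(p, ε)` onto the cone over `E ∩ S(p, ε)`.  For `n = 2` and
`dim E ≤ 1` the base `E ∩ S(p, ε)` is finite and the statement says: near `p`, `E ∖ {p}` is the
disjoint union of finitely many HALF-BRANCHES, continuous curves issuing from `p` each meeting
every small circle about `p` exactly once.  This file proves that planar statement, in the
"branch" form and for an arbitrary o-minimal expansion `L` of the real field
(`IsRealFieldExpansion L`, `L.IsOMinimal ℝ`), directly from the CELL DECOMPOSITION THEOREM of the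
tree (`cellDecomposition_I`, van den Dries Ch. 3 (2.11)) and its dimension theory
(`dim_eq_typeDim`, `dim_le_of_injOn`, Ch. 4 (1.3)–(1.4)) — van den Dries's own proof goes through
the trivialization theorem (Ch. 9 (1.7)); the planar case needs only this much:

* split the punctured plane into the closed upper and the open lower half-plane through `p`;
  on each, `x ↦ (‖x − p‖², x₀)` is a definable chart with definable inverse
  `(t, a) ↦ (a, p₁ ± √(t − (a − p₀)²))`, so the two images `E±` of `E` are definable planar sets
  of dimension `≤ 1` (`dim_le_of_injOn`);
* decompose `ℝ²` (coordinates `(t, a)`) into cells partitioning `E⁺`, `E⁻` and `{t > 0}`; below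
  the least positive "critical value" `b` (base points and base endpoints of the finitely many
  cells) every cell inside `E±` whose base meets `(0, b)` has base `⊇ (0, b)` and, having
  dimension `≤ 1` over an interval base, is the GRAPH of a continuous definable function
  `a = f(t)` (`dim_eq_typeDim`);
* pulling these graphs back through the two inverse charts gives the branches, parametrised by
  `t = ‖x − p‖²`; they are pairwise disjoint (distinct cells are disjoint, the half-planes are
  disjoint) and cover `E ∩ {0 < ‖x − p‖² < b}` (the cells cover).

Main statement: `exists_branches_of_dim_le_one`.  Consumer:
`Literature/Analysis/Calculus/RealAnalyticPlanarZeroSetBranchesOMinimal.lean` (the zero set of a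
planar real-analytic function, `ℝ_an`-definable by `RestrictedAnalyticDefinable.lean`).

## References

* [Dries1998] L. van den Dries, *Tame topology and o-minimal structures*, LMS Lecture Note Series
  248, CUP (1998), Ch. 9 (2.3) pp. 149–150 (local conic structure); Ch. 3 (2.11); Ch. 4 (1.3)–(1.4).
-/

noncomputable section

open Set FirstOrder FirstOrder.Language
open _root_.Filter _root_.Topology

namespace Literature.ModelTheory.ExponentialFields

open CellDimension

namespace PlanarConic

universe u v

variable {L : Language.{u, v}} [L.Structure ℝ]

/-! ### Vectors in `ℝ^{Fin 1}` and `ℝ^{Fin 2}` -/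

omit [L.Structure ℝ] in
/-- `Fin.init` of a pair is the constant `1`-vector of its first entry. [folklore] -/
private theorem init_vec2 (a b : ℝ) : (Fin.init (![a, b] : Fin 2 → ℝ) : Fin 1 → ℝ) = fun _ => a := by
  funext i
  have hi : i = 0 := Subsingleton.elim _ _
  subst hi
  rfl

/-! ### Definability of the square root and of the charts -/

/-- The graph of `Real.sqrt` is definable in any expansion of the real field:
`y = √x ↔ 0 ≤ y ∧ ((x ≤ 0 ∧ y = 0) ∨ (0 ≤ x ∧ y·y = x))`. [cite: Dries1998, Ch. 1 (2.3)] -/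
theorem definable_graph_sqrt (hL : IsRealFieldExpansion L) :
    (univ : Set ℝ).Definable L {v : Fin 2 → ℝ | v 1 = Real.sqrt (v 0)} := by
  have key : {v : Fin 2 → ℝ | v 1 = Real.sqrt (v 0)} =
      {v : Fin 2 → ℝ | 0 ≤ v 1 ∧ ((v 0 ≤ 0 ∧ v 1 = 0) ∨ (0 ≤ v 0 ∧ v 1 * v 1 = v 0))} := by
    ext v
    simp only [mem_setOf_eq]
    constructor
    · intro h
      refine ⟨h ▸ Real.sqrt_nonneg _, ?_⟩
      rcases le_or_gt (v 0) 0 with h0 | h0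
      · exact Or.inl ⟨h0, by rw [h, Real.sqrt_eq_zero'.2 h0]⟩
      · exact Or.inr ⟨h0.le, by rw [h, Real.mul_self_sqrt h0.le]⟩
    · rintro ⟨hy, ⟨h0, h1⟩ | ⟨h0, h1⟩⟩
      · rw [h1, Real.sqrt_eq_zero'.2 h0]
      · rw [← h1, Real.sqrt_mul_self hy]
  rw [key]
  refine definable_setOf_and (hL.definable_setOf_le (IsRealFieldExpansion.definableFun_const _) (definableFun_proj _))
    (definable_setOf_or
      (definable_setOf_and (hL.definable_setOf_le (definableFun_proj _) (IsRealFieldExpansion.definableFun_const _))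
        (definable_setOf_eq' (definableFun_proj _) (IsRealFieldExpansion.definableFun_const _)))
      (definable_setOf_and (hL.definable_setOf_le (IsRealFieldExpansion.definableFun_const _) (definableFun_proj _))
        (definable_setOf_eq' (hL.definableFun_mul (definableFun_proj _) (definableFun_proj _))
          (definableFun_proj _))))

/-- `v ↦ √(g v)` is definable for definable `g`. [cite: Dries1998, Ch. 1 (2.3)] -/
theorem definableFun_sqrt (hL : IsRealFieldExpansion L) {α : Type*} {g : (α → ℝ) → ℝ}
    (hg : (univ : Set ℝ).DefinableFun L g) :
    (univ : Set ℝ).DefinableFun L (fun v => Real.sqrt (g v)) :=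
  definableFun_apply (definable_graph_sqrt hL) hg

/-- The squared distance to `p`, `ρ(x) = (x₀ − p₀)² + (x₁ − p₁)²`, is a definable function.
[cite: Dries1998, Ch. 1 (2.3)] -/
theorem definableFun_rho (hL : IsRealFieldExpansion L) (p : Fin 2 → ℝ) :
    (univ : Set ℝ).DefinableFun L
      (fun x : Fin 2 → ℝ => (x 0 - p 0) ^ 2 + (x 1 - p 1) ^ 2) := by
  have h0 : (univ : Set ℝ).DefinableFun L (fun x : Fin 2 → ℝ => x 0 - p 0) :=
    hL.definableFun_sub (definableFun_proj _) (IsRealFieldExpansion.definableFun_const _)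
  have h1 : (univ : Set ℝ).DefinableFun L (fun x : Fin 2 → ℝ => x 1 - p 1) :=
    hL.definableFun_sub (definableFun_proj _) (IsRealFieldExpansion.definableFun_const _)
  have h := hL.definableFun_add (hL.definableFun_mul h0 h0) (hL.definableFun_mul h1 h1)
  simpa [sq] using h

/-- The second component `p₁ + s·√(t − (a − p₀)²)` of the inverse charts is definable.
[cite: Dries1998, Ch. 1 (2.3)] -/
theorem definableFun_psi1 (hL : IsRealFieldExpansion L) (p : Fin 2 → ℝ) (s : ℝ) :
    (univ : Set ℝ).DefinableFun L
      (fun w : Fin 2 → ℝ => p 1 + s * Real.sqrt (w 0 - (w 1 - p 0) ^ 2)) := by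
  have h1 : (univ : Set ℝ).DefinableFun L (fun w : Fin 2 → ℝ => w 1 - p 0) :=
    hL.definableFun_sub (definableFun_proj _) (IsRealFieldExpansion.definableFun_const _)
  have h2 : (univ : Set ℝ).DefinableFun L (fun w : Fin 2 → ℝ => w 0 - (w 1 - p 0) ^ 2) := by
    simpa [sq] using hL.definableFun_sub (definableFun_proj _) (hL.definableFun_mul h1 h1)
  exact hL.definableFun_add (IsRealFieldExpansion.definableFun_const _)
    (hL.definableFun_const_mul s (definableFun_sqrt hL h2))


/-! ### The two charts of the punctured plane -/

omit [L.Structure ℝ] in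
/-- **The inverse chart undoes the chart on its half-plane**: for `x` in the half-plane `σ`
(`p₁ ≤ x₁` if `σ`, `x₁ < p₁` if not), with `t = ρ(x)` and `a = x₀`,
`(a, p₁ ± √(t − (a − p₀)²)) = x`. [folklore] -/
private theorem chart_inv (p x : Fin 2 → ℝ) (σ : Bool) (hx : if σ then p 1 ≤ x 1 else x 1 < p 1) :
    (![x 0, p 1 + (if σ then (1 : ℝ) else -1) *
        Real.sqrt (((x 0 - p 0) ^ 2 + (x 1 - p 1) ^ 2) - (x 0 - p 0) ^ 2)] : Fin 2 → ℝ) = x := by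
  have hsq : ((x 0 - p 0) ^ 2 + (x 1 - p 1) ^ 2) - (x 0 - p 0) ^ 2 = (x 1 - p 1) ^ 2 := by ring
  rw [hsq, Real.sqrt_sq_eq_abs]
  funext i
  fin_cases i
  · rfl
  · cases σ
    · have hx' : x 1 < p 1 := by simpa using hx
      simp [abs_of_neg (sub_neg.2 hx')]
    · have hx' : p 1 ≤ x 1 := by simpa using hx
      simp [abs_of_nonneg (sub_nonneg.2 hx')]

omit [L.Structure ℝ] in
/-- The inverse charts `(t, a) ↦ (a, p₁ + s·√(t − (a − p₀)²))` are continuous. [folklore] -/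
private theorem continuous_psi (p : Fin 2 → ℝ) (s : ℝ) :
    Continuous (fun w : Fin 2 → ℝ =>
      (![w 1, p 1 + s * Real.sqrt (w 0 - (w 1 - p 0) ^ 2)] : Fin 2 → ℝ)) := by
  refine continuous_pi fun j => ?_
  fin_cases j
  · exact continuous_apply 1
  · exact continuous_const.add (continuous_const.mul
      (Real.continuous_sqrt.comp ((continuous_apply 0).sub
        (((continuous_apply 1).sub continuous_const).pow 2))))

omit [L.Structure ℝ] in
/-- The curve `t ↦ (t, f(t))` of a function continuous on a base containing `(0, b)` is
continuous on `(0, b)`. [folklore] -/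
private theorem continuousOn_graphCurve {X : Set (Fin 1 → ℝ)} {f : (Fin 1 → ℝ) → ℝ}
    (hfc : ContinuousOn f X) {b : ℝ} (hX : ∀ t ∈ Ioo (0 : ℝ) b, (fun _ : Fin 1 => t) ∈ X) :
    ContinuousOn (fun t : ℝ => (![t, f (fun _ : Fin 1 => t)] : Fin 2 → ℝ)) (Ioo 0 b) := by
  have hfcont : ContinuousOn (fun t : ℝ => f (fun _ : Fin 1 => t)) (Ioo 0 b) :=
    hfc.comp (continuous_pi fun _ => continuous_id).continuousOn fun t ht => hX t ht
  refine continuousOn_pi.2 fun j => ?_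
  fin_cases j
  · exact continuousOn_id
  · exact hfcont

/-! ### Cells of `ℝ¹`: critical values -/

omit [L.Structure ℝ] in
/-- All `0`-tuples are equal. [folklore] -/
private theorem fin0_eq (x y : Fin 0 → ℝ) : x = y := funext fun i => i.elim0

/-- **Critical values of a cell of `ℝ¹`.**  A cell `X ⊆ ℝ¹` is a point `{c}` or an open interval
with endpoints in `ℝ ∪ {±∞}`; collecting the point / the finite endpoints in a finite set `F`:
if `0 < b` lies below every positive member of `F` and `X` meets `(0, b)`, then `X ⊇ (0, b)` and
`X` is not a point. [cite: Dries1998, Ch. 3 (2.3)] -/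
theorem exists_critical_finset {κ : Fin 1 → Bool} {X : Set (Fin 1 → ℝ)} (hX : IsCell L 1 κ X) :
    ∃ F : Finset ℝ, ∀ b : ℝ, 0 < b → (∀ c ∈ F, 0 < c → b ≤ c) →
      (∃ t ∈ Ioo (0 : ℝ) b, (fun _ : Fin 1 => t) ∈ X) →
        (∀ t ∈ Ioo (0 : ℝ) b, (fun _ : Fin 1 => t) ∈ X) ∧ κ (Fin.last 0) = true := by
  classical
  obtain ⟨X₀, hX₀, h⟩ := hX
  have hX₀' : X₀ = univ := isCell_zero_iff.1 hX₀
  rcases h with ⟨hlast, f, -, -, rfl⟩ | ⟨hlast, f, g, -, -, -, rfl⟩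
  · -- a point `{c}`, `c = f ()`
    refine ⟨{f Fin.elim0}, fun b hb hF ⟨t, ht, htX⟩ => ?_⟩
    exfalso
    have htc : t = f Fin.elim0 := by
      have h2 := htX.2
      rw [fin0_eq (Fin.init fun _ : Fin 1 => t) Fin.elim0] at h2
      exact h2
    have hbc : b ≤ f Fin.elim0 := hF _ (Finset.mem_singleton_self _) (htc ▸ ht.1)
    exact absurd (htc ▸ ht.2) (not_lt.2 hbc)
  · -- an open interval with optional endpoints `f ()`, `g ()`
    refine ⟨(f.toFinset.image fun f' => f' Fin.elim0) ∪ (g.toFinset.image fun g' => g' Fin.elim0),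
      fun b hb hF ⟨t, ht, htX⟩ => ⟨fun t' ht' => ?_, hlast⟩⟩
    obtain ⟨-, hlo, hhi⟩ := htX
    refine ⟨hX₀' ▸ mem_univ _, fun f' hf' => ?_, fun g' hg' => ?_⟩
    · -- lower endpoint `l = f' () ≤ 0 < t'`
      have hl : f' (Fin.init fun _ : Fin 1 => t) < t := hlo f' hf'
      rw [fin0_eq (Fin.init fun _ : Fin 1 => t) Fin.elim0] at hl
      rw [fin0_eq (Fin.init fun _ : Fin 1 => t') Fin.elim0]
      have hmem : f' Fin.elim0 ∈ (f.toFinset.image fun f' => f' Fin.elim0) ∪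
          (g.toFinset.image fun g' => g' Fin.elim0) :=
        Finset.mem_union_left _ (Finset.mem_image.2 ⟨f', Option.mem_toFinset.2 hf', rfl⟩)
      by_contra hcon
      have hpos : 0 < f' Fin.elim0 := ht'.1.trans_le (not_lt.1 hcon)
      have := hF _ hmem hpos
      exact absurd (hl.trans ht.2) (not_lt.2 this)
    · -- upper endpoint `u = g' () ≥ b > t'`
      have hu : t < g' (Fin.init fun _ : Fin 1 => t) := hhi g' hg'
      rw [fin0_eq (Fin.init fun _ : Fin 1 => t) Fin.elim0] at hu
      rw [fin0_eq (Fin.init fun _ : Fin 1 => t') Fin.elim0]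
      have hmem : g' Fin.elim0 ∈ (f.toFinset.image fun f' => f' Fin.elim0) ∪
          (g.toFinset.image fun g' => g' Fin.elim0) :=
        Finset.mem_union_right _ (Finset.mem_image.2 ⟨g', Option.mem_toFinset.2 hg', rfl⟩)
      have hpos : 0 < g' Fin.elim0 := ht.1.trans hu
      exact ht'.2.trans_le (hF _ hmem hpos)

/-! ### Cells of `ℝ²` of dimension `≤ 1` over an interval are graphs -/

omit [L.Structure ℝ] in
/-- A type `ι : Fin 2 → Bool` with both entries `true` has `typeDim ι = 2`. [cite: Dries1998, Ch. 4 (1.1)] -/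
theorem typeDim_eq_two {ι : Fin 2 → Bool} (h0 : ι 0 = true) (h1 : ι 1 = true) : typeDim ι = 2 := by
  unfold typeDim
  have : (Finset.univ.filter fun j => ι j = true) = Finset.univ := by
    ext j
    simp only [Finset.mem_filter, Finset.mem_univ, true_and, iff_true]
    fin_cases j
    · exact h0
    · exact h1
  rw [this]
  simp

/-- **A cell of `ℝ²` of dimension `≤ 1` whose base contains two points is a graph**: there is a
definable `f`, continuous on the base `π(C)`, with `C = Γ(f)` over `π(C)`.
[cite: Dries1998, Ch. 3 (2.3) and Ch. 4 (1.4)] -/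
theorem exists_graph_of_typeDim_le_one {ι : Fin 2 → Bool} {C : Set (Fin 2 → ℝ)}
    (hC : IsCell L 2 ι C) (hdim : typeDim ι ≤ 1) {t₁ t₂ : ℝ} (hne : t₁ ≠ t₂)
    (h₁ : (fun _ : Fin 1 => t₁) ∈ Fin.init '' C) (h₂ : (fun _ : Fin 1 => t₂) ∈ Fin.init '' C) :
    ∃ f : (Fin 1 → ℝ) → ℝ, (univ : Set ℝ).DefinableFun L f ∧ ContinuousOn f (Fin.init '' C) ∧
      ∀ v : Fin 2 → ℝ, v ∈ C ↔ Fin.init v ∈ Fin.init '' C ∧ v 1 = f (Fin.init v) := by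
  obtain ⟨X, hX, h⟩ := hC
  rcases h with ⟨hlast, f, hf, hfc, rfl⟩ | ⟨hlast, f, g, hf, hg, hfg, hCeq⟩
  · -- graph over `X = π(C)`
    have hXeq : Fin.init '' {v : Fin 2 → ℝ | Fin.init v ∈ X ∧ v (Fin.last 1) = f (Fin.init v)} = X := by
      ext x
      constructor
      · rintro ⟨v, hv, rfl⟩
        exact hv.1
      · intro hx
        exact ⟨Fin.snoc x (f x), ⟨by simpa using hx, by rw [Fin.init_snoc, Fin.snoc_last]⟩, by simp⟩
    refine ⟨f, hf, by rwa [hXeq], fun v => ?_⟩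
    rw [hXeq]
    rfl
  · -- a band: then `ι 0 = false` and the base is a point — impossible
    exfalso
    have h1 : ι 1 = true := hlast
    have h0 : ι 0 = false := by
      by_contra h0
      have h0' : ι 0 = true := by
        cases h : ι 0
        · exact absurd h h0
        · rfl
      have := typeDim_eq_two h0' h1
      omega
    -- the base `X ⊇ π(C)` is a graph cell of `ℝ¹`, i.e. a point
    have hsub : Fin.init '' C ⊆ X := by
      rintro _ ⟨v, hv, rfl⟩
      rw [hCeq] at hv
      exact hv.1
    obtain ⟨X₀, -, hX'⟩ := hX
    have hinit : Fin.init ι (Fin.last 0) = false := h0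
    rcases hX' with ⟨-, f₀, -, -, rfl⟩ | ⟨hlast₀, -⟩
    · have e₁ := (hsub h₁).2
      have e₂ := (hsub h₂).2
      rw [fin0_eq (Fin.init fun _ : Fin 1 => t₁) Fin.elim0] at e₁
      rw [fin0_eq (Fin.init fun _ : Fin 1 => t₂) Fin.elim0] at e₂
      exact hne (e₁.trans e₂.symm)
    · rw [hinit] at hlast₀
      exact absurd hlast₀ (by simp)

/-! ### The main statement -/

/-- **Local conic structure of a one-dimensional definable planar set, branch form**
(van den Dries 1998, Ch. 9 (2.3) for `n = 2`, `dim E ≤ 1`).  Let `L` be an o-minimal expansion of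
the real field, `E ⊆ ℝ²` definable with `dim E ≤ 1`, and `p ∈ ℝ²`.  Then there are `b > 0` and
finitely many curves `γ₁, …, γ_m : (0, b) → ℝ²`, continuous, with `‖γ_i(t) − p‖² = t`
(squared-distance parametrisation), `γ_i(t) ∈ E`, pairwise disjoint, such that every `x ∈ E` with
`0 < ‖x − p‖² < b` is `γ_i(‖x − p‖²)` for some `i`. [cite: Dries1998, Ch. 9 (2.3) pp. 149–150] -/
theorem exists_branches_of_dim_le_one (hL : IsRealFieldExpansion L) (hO : L.IsOMinimal ℝ)
    {E : Set (Fin 2 → ℝ)} (hE : (univ : Set ℝ).Definable L E) (hdim : dim L 2 E ≤ 1)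
    (p : Fin 2 → ℝ) :
    ∃ b : ℝ, 0 < b ∧ ∃ (m : ℕ) (γ : Fin m → ℝ → (Fin 2 → ℝ)),
      (∀ i, ContinuousOn (γ i) (Ioo 0 b)) ∧
      (∀ i, ∀ t ∈ Ioo (0 : ℝ) b,
        γ i t ∈ E ∧ (γ i t 0 - p 0) ^ 2 + (γ i t 1 - p 1) ^ 2 = t) ∧
      (∀ i j, ∀ t ∈ Ioo (0 : ℝ) b, γ i t = γ j t → i = j) ∧
      (∀ x ∈ E, 0 < (x 0 - p 0) ^ 2 + (x 1 - p 1) ^ 2 →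
        (x 0 - p 0) ^ 2 + (x 1 - p 1) ^ 2 < b →
          ∃ i, x = γ i ((x 0 - p 0) ^ 2 + (x 1 - p 1) ^ 2)) := by
  classical
  have hlt := hL.definable_lt
  -- the chart `Φ` and the inverse charts `Ψ σ`
  set ρ : (Fin 2 → ℝ) → ℝ := fun x => (x 0 - p 0) ^ 2 + (x 1 - p 1) ^ 2 with hρ
  set Φ : (Fin 2 → ℝ) → (Fin 2 → ℝ) := fun x => ![ρ x, x 0] with hΦ
  set sg : Bool → ℝ := fun σ => if σ then 1 else -1 with hsg
  set Ψ : Bool → (Fin 2 → ℝ) → (Fin 2 → ℝ) := fun σ w =>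
    ![w 1, p 1 + sg σ * Real.sqrt (w 0 - (w 1 - p 0) ^ 2)] with hΨ
  set H : Bool → Set (Fin 2 → ℝ) := fun σ => {x | if σ then p 1 ≤ x 1 else x 1 < p 1} with hH
  -- `Ψ σ ∘ Φ = id` on `H σ`
  have hinv : ∀ σ, ∀ x ∈ H σ, Ψ σ (Φ x) = x := by
    intro σ x hx
    have h := chart_inv p x σ hx
    simp only [hΨ, hΦ, hρ, hsg, Matrix.cons_val_zero, Matrix.cons_val_one]
    exact h
  have hΦ0 : ∀ x, Φ x 0 = ρ x := fun x => rfl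
  have hΦ1 : ∀ x, Φ x 1 = x 0 := fun x => rfl
  -- the two images `E^σ`
  set Eσ : Bool → Set (Fin 2 → ℝ) := fun σ => Φ '' (E ∩ H σ ∩ {x | 0 < ρ x}) with hEσ
  -- definability
  have hρdef : (univ : Set ℝ).DefinableFun L ρ := definableFun_rho hL p
  have hHdef : ∀ σ, (univ : Set ℝ).Definable L (H σ) := by
    intro σ
    cases σ
    · simpa [hH] using hL.definable_setOf_lt (definableFun_proj (1 : Fin 2)) (IsRealFieldExpansion.definableFun_const (p 1))
    · simpa [hH] using hL.definable_setOf_le (IsRealFieldExpansion.definableFun_const (p 1)) (definableFun_proj (1 : Fin 2))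
  have hEσdef : ∀ σ, (univ : Set ℝ).Definable L (Eσ σ) := by
    intro σ
    refine definable_image ((hE.inter (hHdef σ)).inter
      (hL.definable_setOf_lt (IsRealFieldExpansion.definableFun_const 0) hρdef)) fun j => ?_
    fin_cases j
    · simpa [hΦ] using hρdef
    · simpa [hΦ] using (definableFun_proj (L := L) (M := ℝ) (0 : Fin 2))
  have hΨdef : ∀ σ, (univ : Set ℝ).DefinableMap L (Ψ σ) := by
    intro σ j
    fin_cases j
    · simpa [hΨ] using (definableFun_proj (L := L) (M := ℝ) (1 : Fin 2))
    · simpa [hΨ] using definableFun_psi1 hL p (sg σ)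
  -- dimension of the images
  have hdimσ : ∀ σ, dim L 2 (Eσ σ) ≤ 1 := by
    intro σ
    refine le_trans (dim_le_of_injOn hO hlt (hΨdef σ) ?_ ?_) hdim
    · rintro _ ⟨x, ⟨⟨-, hxH⟩, -⟩, rfl⟩ _ ⟨x', ⟨⟨-, hx'H⟩, -⟩, rfl⟩ h
      rw [hinv σ x hxH, hinv σ x' hx'H] at h
      rw [h]
    · rintro _ ⟨_, ⟨x, ⟨⟨hxE, hxH⟩, -⟩, rfl⟩, rfl⟩
      rwa [hinv σ x hxH]
  -- cell decomposition of `ℝ²` partitioning `E⁺`, `E⁻` and `{t > 0}`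
  set S₀ : Set (Fin 2 → ℝ) := {w | 0 < w 0} with hS₀
  have hS₀def : (univ : Set ℝ).Definable L S₀ :=
    hL.definable_setOf_lt (IsRealFieldExpansion.definableFun_const 0) (definableFun_proj (0 : Fin 2))
  obtain ⟨𝒟, h𝒟, hpart⟩ := CellDecomposition.cellDecomposition_I hO hlt ({Eσ true, Eσ false, S₀} : Finset _)
    (by
      intro Y hY
      simp only [Finset.mem_insert, Finset.mem_singleton] at hY
      rcases hY with rfl | rfl | rfl
      · exact hEσdef true
      · exact hEσdef false
      · exact hS₀def)
  -- critical values of the bases, and `b`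
  have hcrit : ∀ C ∈ 𝒟, ∃ F : Finset ℝ, ∀ b : ℝ, 0 < b → (∀ c ∈ F, 0 < c → b ≤ c) →
      (∃ t ∈ Ioo (0 : ℝ) b, (fun _ : Fin 1 => t) ∈ Fin.init '' C) →
        ∀ t ∈ Ioo (0 : ℝ) b, (fun _ : Fin 1 => t) ∈ Fin.init '' C := by
    intro C hC
    obtain ⟨ι, hCι⟩ := h𝒟.isCell C hC
    obtain ⟨F, hF⟩ := exists_critical_finset hCι.image_init
    exact ⟨F, fun b hb hbF hex => (hF b hb hbF hex).1⟩
  choose! F hF using hcrit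
  set P : Finset ℝ := ((𝒟.biUnion F).filter fun c => 0 < c) ∪ {1} with hP
  have hPne : P.Nonempty := ⟨1, by simp [hP]⟩
  set b : ℝ := P.min' hPne with hb
  have hb0 : 0 < b := by
    have hmem := P.min'_mem hPne
    rw [← hb] at hmem
    simp only [hP, Finset.mem_union, Finset.mem_filter, Finset.mem_singleton] at hmem
    rcases hmem with ⟨-, h⟩ | h
    · exact h
    · rw [h]; exact one_pos
  have hbF : ∀ C ∈ 𝒟, ∀ c ∈ F C, 0 < c → b ≤ c := by
    intro C hC c hc hc0
    refine P.min'_le c ?_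
    simp only [hP, Finset.mem_union, Finset.mem_filter, Finset.mem_biUnion, Finset.mem_singleton]
    exact Or.inl ⟨⟨C, hC, hc⟩, hc0⟩
  have hbase : ∀ C ∈ 𝒟, (∃ t ∈ Ioo (0 : ℝ) b, (fun _ : Fin 1 => t) ∈ Fin.init '' C) →
      ∀ t ∈ Ioo (0 : ℝ) b, (fun _ : Fin 1 => t) ∈ Fin.init '' C :=
    fun C hC => hF C hC b hb0 (hbF C hC)
  -- graph cells: every cell inside some `E^σ` whose base meets `(0, b)` is a graph over `⊇ (0,b)`
  have hgraph : ∀ C ∈ 𝒟, ∀ σ, C ⊆ Eσ σ →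
      (∃ t ∈ Ioo (0 : ℝ) b, (fun _ : Fin 1 => t) ∈ Fin.init '' C) →
      ∃ f : (Fin 1 → ℝ) → ℝ, (univ : Set ℝ).DefinableFun L f ∧ ContinuousOn f (Fin.init '' C) ∧
        ∀ v : Fin 2 → ℝ, v ∈ C ↔ Fin.init v ∈ Fin.init '' C ∧ v 1 = f (Fin.init v) := by
    intro C hC σ hCσ hex
    obtain ⟨ι, hCι⟩ := h𝒟.isCell C hC
    have hd : typeDim ι ≤ 1 := by
      rw [← dim_eq_typeDim hO hlt hCι]
      exact (dim_mono hCσ).trans (hdimσ σ)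
    have hb2 : b / 2 ∈ Ioo (0 : ℝ) b := ⟨by positivity, by linarith⟩
    have hb3 : b / 3 ∈ Ioo (0 : ℝ) b := ⟨by positivity, by linarith⟩
    exact exists_graph_of_typeDim_le_one hCι hd (by linarith : b / 2 ≠ b / 3)
      (hbase C hC hex _ hb2) (hbase C hC hex _ hb3)
  -- the index set of branches
  set I : Finset (Set (Fin 2 → ℝ) × Bool) := (𝒟 ×ˢ Finset.univ).filter fun Cσ =>
    Cσ.1 ⊆ Eσ Cσ.2 ∧ ∃ t ∈ Ioo (0 : ℝ) b, (fun _ : Fin 1 => t) ∈ Fin.init '' Cσ.1 with hI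
  have hImem : ∀ {Cσ}, Cσ ∈ I ↔ Cσ.1 ∈ 𝒟 ∧ Cσ.1 ⊆ Eσ Cσ.2 ∧
      ∃ t ∈ Ioo (0 : ℝ) b, (fun _ : Fin 1 => t) ∈ Fin.init '' Cσ.1 := by
    intro Cσ
    simp only [hI, Finset.mem_filter, Finset.mem_product, Finset.mem_univ, and_true]
  have hfun : ∀ Cσ ∈ I, ∃ f : (Fin 1 → ℝ) → ℝ, ContinuousOn f (Fin.init '' Cσ.1) ∧
      ∀ v : Fin 2 → ℝ, v ∈ Cσ.1 ↔ Fin.init v ∈ Fin.init '' Cσ.1 ∧ v 1 = f (Fin.init v) := by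
    intro Cσ hCσ
    obtain ⟨hC, hsub, hex⟩ := hImem.1 hCσ
    obtain ⟨f, -, hfc, hfC⟩ := hgraph _ hC _ hsub hex
    exact ⟨f, hfc, hfC⟩
  choose! f hfc hfC using hfun
  -- the branches
  set m := I.card with hm
  set e : Fin m ≃ {x // x ∈ I} := (I.equivFin).symm with he
  set γ : Fin m → ℝ → (Fin 2 → ℝ) := fun i t =>
    Ψ (e i).1.2 (![t, f (e i).1 (fun _ => t)]) with hγ
  -- the graph point over `t` lies in the cell, hence in `E^σ`; name its preimage
  have hcell : ∀ i, ∀ t ∈ Ioo (0 : ℝ) b,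
      (![t, f (e i).1 (fun _ => t)] : Fin 2 → ℝ) ∈ (e i).1.1 := by
    intro i t ht
    obtain ⟨hC, hsub, hex⟩ := hImem.1 (e i).2
    rw [hfC _ (e i).2]
    refine ⟨?_, ?_⟩
    · rw [init_vec2]
      exact hbase _ hC hex t ht
    · simp [init_vec2]
  have hpre : ∀ i, ∀ t ∈ Ioo (0 : ℝ) b, ∃ x, x ∈ E ∧ x ∈ H (e i).1.2 ∧ 0 < ρ x ∧
      Φ x = ![t, f (e i).1 (fun _ => t)] ∧ γ i t = x := by
    intro i t ht
    obtain ⟨hC, hsub, -⟩ := hImem.1 (e i).2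
    obtain ⟨x, ⟨⟨hxE, hxH⟩, hxρ⟩, hx⟩ := hsub (hcell i t ht)
    refine ⟨x, hxE, hxH, hxρ, hx, ?_⟩
    show Ψ (e i).1.2 _ = x
    rw [← hx, hinv _ x hxH]
  refine ⟨b, hb0, m, γ, fun i => ?_, fun i t ht => ?_, fun i j t ht hij => ?_, fun x hxE hρ0 hρb => ?_⟩
  · -- continuity on `(0, b)`
    obtain ⟨hC, hsub, hex⟩ := hImem.1 (e i).2
    have hw : ContinuousOn (fun t : ℝ => (![t, f (e i).1 (fun _ : Fin 1 => t)] : Fin 2 → ℝ))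
        (Ioo 0 b) := continuousOn_graphCurve (hfc _ (e i).2) fun t ht => hbase _ hC hex t ht
    have hΨc : Continuous (Ψ (e i).1.2) := continuous_psi p (sg (e i).1.2)
    exact hΨc.comp_continuousOn hw
  · -- in `E`, at squared distance `t`
    obtain ⟨x, hxE, -, -, hΦx, hγx⟩ := hpre i t ht
    rw [hγx]
    refine ⟨hxE, ?_⟩
    have h0 := congrFun hΦx 0
    simpa [hΦ, hρ] using h0
  · -- disjointness
    obtain ⟨x, -, hxH, -, hΦx, hγx⟩ := hpre i t ht
    obtain ⟨x', -, hx'H, -, hΦx', hγx'⟩ := hpre j t ht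
    have hxx' : x = x' := by rw [← hγx, hij, hγx']
    subst hxx'
    -- same half-plane
    have hσ : (e i).1.2 = (e j).1.2 := by
      revert hxH hx'H
      cases (e i).1.2 <;> cases (e j).1.2 <;> simp [hH]
    -- same cell
    have hCC : (e i).1.1 = (e j).1.1 :=
      h𝒟.eq_of_mem (hImem.1 (e i).2).1 (hImem.1 (e j).2).1 (hΦx ▸ hcell i t ht)
        (hΦx' ▸ hcell j t ht)
    have : (e i : Set (Fin 2 → ℝ) × Bool) = e j := Prod.ext hCC hσ
    exact e.injective (Subtype.ext this)
  · -- covering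
    set σ : Bool := decide (p 1 ≤ x 1) with hσdef
    have hxH : x ∈ H σ := by
      by_cases h : p 1 ≤ x 1
      · simp [hH, hσdef, h]
      · simp [hH, hσdef, h, lt_of_not_ge h]
    have hΦE : Φ x ∈ Eσ σ := ⟨x, ⟨⟨hxE, hxH⟩, hρ0⟩, rfl⟩
    obtain ⟨C, hC, hΦC⟩ := h𝒟.exists_mem (Φ x)
    have hCsub : C ⊆ Eσ σ := by
      have hY : Eσ σ ∈ ({Eσ true, Eσ false, S₀} : Finset _) := by
        cases σ <;> simp
      rcases hpart _ hY C hC with h | h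
      · exact h
      · exact absurd hΦE (disjoint_left.1 h hΦC)
    have hbaseΦ : (fun _ : Fin 1 => ρ x) ∈ Fin.init '' C :=
      ⟨Φ x, hΦC, by rw [show Φ x = ![ρ x, x 0] from rfl, init_vec2]⟩
    have hex : ∃ t ∈ Ioo (0 : ℝ) b, (fun _ : Fin 1 => t) ∈ Fin.init '' C := ⟨ρ x, ⟨hρ0, hρb⟩, hbaseΦ⟩
    have hCσI : (C, σ) ∈ I := hImem.2 ⟨hC, hCsub, hex⟩
    set i : Fin m := e.symm ⟨(C, σ), hCσI⟩ with hidef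
    have hei : (e i : Set (Fin 2 → ℝ) × Bool) = (C, σ) := by simp [hidef]
    refine ⟨i, ?_⟩
    -- `x₀ = f_C (ρ x)` because `Φ x ∈ C = Γ(f_C)`
    have hx0 : x 0 = f (C, σ) (fun _ => ρ x) := by
      have h := ((hfC _ hCσI (Φ x)).1 hΦC).2
      rw [show Φ x = ![ρ x, x 0] from rfl, init_vec2] at h
      simpa using h
    show x = Ψ (e i).1.2 (![ρ x, f (e i).1 (fun _ => ρ x)])
    rw [hei]
    show x = Ψ σ (![ρ x, f (C, σ) (fun _ => ρ x)])
    rw [← hx0, ← show Φ x = ![ρ x, x 0] from rfl, hinv σ x hxH]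

end PlanarConic

end Literature.ModelTheory.ExponentialFields

end
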